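import Summits.QuantumFields.BalabanUV.T4Continuum.Support.NE7K1LinWalkPadE
import Summits.QuantumFields.BalabanUV.T4Continuum.Support.NE7K1LinWalkDeltaRegion
import Summits.QuantumFields.BalabanUV.T4Continuum.Support.NE7K1LinWalkLineHcomm

/-!
# NE7K1LinWalkLinePad — row NE7 (node U5), candidate route HOM, path H1L, cell K1-lin(s): THE TWO-CUTOFF LINE's EXTENDED OPERATOR `𝒫♮(s)` ON
# TWO REGIONS — the injection `Idx L R′ → Idx L R′₀` of the coordinate labels, the padded `𝒫♮_Ω(s)` on `Idx L R′₀`, and THE AGREEMENT OF THE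
# ENTRIES AT INTERIOR COARSE SITES (`𝒫♮_Ω(s)(c,c′) = 𝒫♮_{Ω₀}(s)(c,c′)` whenever all `Ω₀`-neighbours of `site c` lie in `Ω`)

Lineage `b2b-balaban-t4-ne7-p2` (CRUX PROVER NE7 #2), generation 71; series (RW) file 26 = the line analogue of file 24's §1 (the entry analysis
of `fineOpR` on two regions), for the ψ-rescaled extended operator `𝒫♮(s) = extLine` of files 9 ∕ 11 ∕ 13 (`NE7K1LinWalkLine`,
`NE7K1LinWalkLineEntries`, `NE7K1LinWalkLineHcomm`), over the padding device of file 25 (`NE7K1LinWalkPadE`).  [Balaban1983RegularityDecay] =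
T. Bałaban, Commun. Math. Phys. 89 (1983) 571–597, p. 579: «The terms with ω such that □_{ω_i} are interior cubes of Ω are the same in both
representations» — for the LINE at U = 1 the operator expanded is `𝒫♮(s)` (file 9), and this file proves that sentence for it.

THE SETTING.  Two fine regions `R′ ⊆ R′₀ ⊂ ℤ^{d+1}`, both unions of `L`-blocks (`hR′L`, `hR′₀L`); coarse sites `Ω = R′.image (blk L) ⊆
Ω₀ = R′₀.image (blk L)`; coordinate labels `Idx L R′ = ↥Ω ⊕ ↥Ω × NZ d L` (block mean ⊕ in-block fluctuations).

* §1 `phiL` ∕ `psiL`: the injection `Idx L R′ → Idx L R′₀` (inclusion on the site, identity on the offset) and its partial inverse, `psiL_phiL`,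
  `phiL_psiL`, `site_phiL`; `mem_of_blk_mem` (a union of `L`-blocks contains every fine point over its coarse sites).
* §2 THE COORDINATE MATRIX ON TWO REGIONS: **`coordT_phiL`** — `T_{Ω₀}(x′, φc) = T_Ω(x′, c)` for `x′ ∈ R′` and `0` for `x′ ∉ R′` (the block
  indicator and the chart points of `site c ∈ Ω` live in `R′`); `blk_eq_site_of_coordT_ne_zero` (a nonzero `T_{x′c}` puts `x′` in the block of
  `site c`).
* §3 **THE AGREEMENT**: `fine_nbr_mem` (fine neighbours inside `R′₀` of a fine point over an INTERIOR coarse site lie in `R′` —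
  `NE7K1LinWalkLineEntries.blk_eq_or_mem_nbrs_of_mem_nbrs`), **`runB_phiL`** (`H_B^{Ω₀}(φc, φc′) = H_B^{Ω}(c, c′)` when `site c` is interior: the
  double sum `L^{−(d+1)}Σ_{x′y′}T_{x′c}P_f(x′,y′)T_{y′c′}` over `R′₀` restricts to `R′` by §2, and there `P_f^{R′₀} = P_f^{R′}` entrywise by file
  24's `fineOpR_apply_eq_of_interior` — only the ROW site matters), **`extLine_phiL`** (the four blocks of `𝒫♮(s)` by
  `NE7K1LinWalkLineHcomm.extLine_apply_*`; the coarse block `P_A` by `fineOpR_apply_eq_of_interior` on `Ω ⊆ Ω₀`), and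
  **`padE_extLine_agree`**: for a label `J ∉ bdryLab W ρ K Ω Ω₀` (file 24) the padded `𝒫♮_Ω(s)` and `𝒫♮_{Ω₀}(s)` have THE SAME `S_J × S_J`
  BLOCK on the lifted regions `{c : site c ∈ region Ω₀ W ρ J}` — the agreement hypothesis of file 22 for the line.

HONEST FRAMING: [folklore] entry bookkeeping; A = 0, U = 1; nothing of Bałaban's asserted; no `sorry`.  Census only (file 27 assembles the line's
`δG` clause); NO letter ∕ tag ∕ size of NE7 moves; NE7 NOT PRINTED ∕ NOT PROVED; spine 0∕9; FIXED FINITE T⁴, rung (B)+1; NOT infinite volume, NOT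
mass gap, NOT Clay.  HONEST DEPENDENCY: continuum YM on T⁴ ⇐ BetaPertH ∧ nine spine estimates (0/9 proved); BetaPertH ⇐ (D1) ∧ (D4) ∧
CAP+tail; G-an2-4 gates asym, D1 and NE2/3/4.
-/

noncomputable section

open Finset Matrix

namespace Summit.QuantumFields.BalabanUV.T4Continuum.NE7K1LinWalkLinePad

open Literature.MathematicalPhysics.QuantumFieldTheory.Balaban1983to89
open Literature.MathematicalPhysics.QuantumFieldTheory.Balaban1983to89.B4Reflection242
open Literature.MathematicalPhysics.QuantumFieldTheory.Balaban1983to89.B4BoxCov237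
open Literature.MathematicalPhysics.QuantumFieldTheory.Balaban1983to89.B4Lower18
open Literature.MathematicalPhysics.QuantumFieldTheory.Balaban1983to89.B4Green244 (finePt)
open NE7K1LinBlockCoords NE7K1LinSchurLineU1 NE7K1LinSchurLineU1Sharp NE7K1LinWalkBox NE7K1LinWalkLine NE7K1LinWalkLineEntries
  NE7K1LinWalkLineHcomm NE7K1LinWalkPad NE7K1LinWalkPadE NE7K1LinWalkDeltaRegion NE7K1LinWalkFineOp

variable {d : ℕ} {L : ℕ} [NeZero L] {R' R'₀ : Finset (Fin (d + 1) → ℤ)}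

/-! ### §1 The injection of coordinate labels and its partial inverse -/

/-- the injection `Idx L R′ → Idx L R′₀` over an inclusion of the coarse sites: inclusion on the site, identity on the offset. [folklore] -/
def phiL (h : R'.image (blk L) ⊆ R'₀.image (blk L)) : Idx L R' → Idx L R'₀
  | Sum.inl b => Sum.inl (incl h b)
  | Sum.inr q => Sum.inr (incl h q.1, q.2)

/-- its partial inverse. [folklore] -/
def psiL (R' : Finset (Fin (d + 1) → ℤ)) : Idx L R'₀ → Option (Idx L R')
  | Sum.inl b => if hb : b.1 ∈ R'.image (blk L) then some (Sum.inl ⟨b.1, hb⟩) else none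
  | Sum.inr q => if hb : q.1.1 ∈ R'.image (blk L) then some (Sum.inr (⟨q.1.1, hb⟩, q.2)) else none

/-- `ψ (φ c) = some c`. [folklore] -/
theorem psiL_phiL (h : R'.image (blk L) ⊆ R'₀.image (blk L)) (c : Idx L R') : psiL R' (phiL h c) = some c := by
  rcases c with b | ⟨b, j⟩
  · simp only [phiL, psiL, incl, dif_pos b.2]
  · simp only [phiL, psiL, incl, dif_pos b.2]

/-- `ψ x = some c ⇒ φ c = x`. [folklore] -/
theorem phiL_psiL (h : R'.image (blk L) ⊆ R'₀.image (blk L)) (x : Idx L R'₀) (c : Idx L R') (hx : psiL R' x = some c) :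
    phiL h c = x := by
  rcases x with b | ⟨b, j⟩
  · by_cases hb : b.1 ∈ R'.image (blk L)
    · simp only [psiL, dif_pos hb, Option.some.injEq] at hx
      subst hx
      rfl
    · simp only [psiL, dif_neg hb] at hx
      exact absurd hx (by simp)
  · by_cases hb : b.1 ∈ R'.image (blk L)
    · simp only [psiL, dif_pos hb, Option.some.injEq] at hx
      subst hx
      rfl
    · simp only [psiL, dif_neg hb] at hx
      exact absurd hx (by simp)

/-- `ψ x = none` iff the site of `x` is not a coarse site of `Ω`. [folklore] -/
theorem psiL_eq_none_iff (x : Idx L R'₀) : psiL R' x = none ↔ (site x).1 ∉ R'.image (blk L) := by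
  rcases x with b | ⟨b, j⟩
  · by_cases hb : b.1 ∈ R'.image (blk L)
    · simp only [psiL, dif_pos hb, site]; simp [hb]
    · simp only [psiL, dif_neg hb, site]; simp [hb]
  · by_cases hb : b.1 ∈ R'.image (blk L)
    · simp only [psiL, dif_pos hb, site]; simp [hb]
    · simp only [psiL, dif_neg hb, site]; simp [hb]

/-- the site of the image is the included site. [folklore] -/
theorem site_phiL (h : R'.image (blk L) ⊆ R'₀.image (blk L)) (c : Idx L R') : site (phiL h c) = incl h (site c) := by
  rcases c with b | ⟨b, j⟩ <;> rfl

omit [NeZero L] in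
/-- a union of `L`-blocks contains every fine point over its coarse sites. [folklore] -/
theorem mem_of_blk_mem (hR'L : IsBlockUnion L R') {x : Fin (d + 1) → ℤ} (hx : blk L x ∈ R'.image (blk L)) : x ∈ R' := by
  obtain ⟨x'', hx'', hbx⟩ := Finset.mem_image.1 hx
  exact hR'L hx'' hbx.symm

/-! ### §2 The coordinate matrix on two regions -/

/-- **`T` ON TWO REGIONS**: `T_{Ω₀}(x′, φc) = T_Ω(x′, c)` for `x′ ∈ R′`, and `= 0` for `x′ ∉ R′`. [folklore] -/
theorem coordT_phiL (hR'L : IsBlockUnion L R') (hR'₀L : IsBlockUnion L R'₀) (hsub : R' ⊆ R'₀) (x' : ↥R'₀) (c : Idx L R') :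
    coordT hR'₀L x' (phiL (Finset.image_subset_image hsub) c) =
      if hx : x'.1 ∈ R' then coordT hR'L ⟨x'.1, hx⟩ c else 0 := by
  have hL : 1 ≤ L := NeZero.one_le
  rcases c with b | ⟨b, j⟩
  · -- the block indicator
    simp only [phiL, coordT_apply_inl]
    by_cases hx : x'.1 ∈ R'
    · rw [dif_pos hx]
      have e : (rblk L R'₀ x' = incl (Finset.image_subset_image hsub) b) ↔ (rblk L R' ⟨x'.1, hx⟩ = b) := by
        rw [Subtype.ext_iff, Subtype.ext_iff]; rfl
      by_cases hb : rblk L R' ⟨x'.1, hx⟩ = b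
      · rw [if_pos hb, if_pos (e.2 hb)]
      · rw [if_neg hb, if_neg (fun h => hb (e.1 h))]
    · rw [dif_neg hx, if_neg]
      intro h
      apply hx
      have hb : blk L x'.1 = b.1 := congrArg Subtype.val h
      exact mem_of_blk_mem hR'L (hb ▸ b.2)
  · -- the fluctuation column
    simp only [phiL, coordT_apply_inr]
    have e1 : ∀ j' : Fin (d + 1) → Fin L, (x' = rchart NeZero.one_le hR'₀L (incl (Finset.image_subset_image hsub) b) j') ↔
        x'.1 = finePt L b.1 j' := fun j' => by rw [Subtype.ext_iff]; rfl
    by_cases hx : x'.1 ∈ R'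
    · rw [dif_pos hx]
      have e2 : ∀ j' : Fin (d + 1) → Fin L, ((⟨x'.1, hx⟩ : ↥R') = rchart NeZero.one_le hR'L b j') ↔ x'.1 = finePt L b.1 j' :=
        fun j' => by rw [Subtype.ext_iff]; rfl
      have h1 : (if x' = rchart NeZero.one_le hR'₀L (incl (Finset.image_subset_image hsub) b) j.1 then (1 : ℝ) else 0) =
          (if (⟨x'.1, hx⟩ : ↥R') = rchart NeZero.one_le hR'L b j.1 then (1 : ℝ) else 0) := by
        by_cases h : x'.1 = finePt L b.1 j.1
        · rw [if_pos ((e1 _).2 h), if_pos ((e2 _).2 h)]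
        · rw [if_neg (fun h' => h ((e1 _).1 h')), if_neg (fun h' => h ((e2 _).1 h'))]
      have h0 : (if x' = rchart NeZero.one_le hR'₀L (incl (Finset.image_subset_image hsub) b) 0 then (1 : ℝ) else 0) =
          (if (⟨x'.1, hx⟩ : ↥R') = rchart NeZero.one_le hR'L b 0 then (1 : ℝ) else 0) := by
        by_cases h : x'.1 = finePt L b.1 0
        · rw [if_pos ((e1 _).2 h), if_pos ((e2 _).2 h)]
        · rw [if_neg (fun h' => h ((e1 _).1 h')), if_neg (fun h' => h ((e2 _).1 h'))]
      rw [h1, h0]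
    · rw [dif_neg hx]
      have hnot : ∀ j' : Fin (d + 1) → Fin L, ¬ x' = rchart NeZero.one_le hR'₀L (incl (Finset.image_subset_image hsub) b) j' := by
        intro j' h
        apply hx
        rw [(e1 j').1 h]
        exact (rchart NeZero.one_le hR'L b j').2
      rw [if_neg (hnot _), if_neg (hnot _), sub_zero]

/-- a nonzero `T_{x′c}` puts `x′` in the block of `site c`. [folklore] -/
theorem blk_eq_site_of_coordT_ne_zero (hR'L : IsBlockUnion L R') {x' : ↥R'} {c : Idx L R'} (h : coordT hR'L x' c ≠ 0) :
    blk L x'.1 = (site c).1 := by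
  have hL : 1 ≤ L := NeZero.one_le
  rcases c with b | ⟨b, j⟩
  · rw [coordT_apply_inl] at h
    by_cases hb : rblk L R' x' = b
    · exact congrArg Subtype.val hb
    · exact absurd (if_neg hb) h
  · rw [coordT_apply_inr] at h
    by_cases h1 : x' = rchart NeZero.one_le hR'L b j.1
    · have := congrArg Subtype.val (rblk_rchart hL hR'L b j.1)
      rw [← h1] at this
      exact this
    · by_cases h0 : x' = rchart NeZero.one_le hR'L b 0
      · have := congrArg Subtype.val (rblk_rchart hL hR'L b 0)
        rw [← h0] at this
        exact this
      · rw [if_neg h1, if_neg h0, sub_zero] at h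
        exact absurd rfl h

/-! ### §3 The agreement of `H_B` and of `𝒫♮(s)` at interior coarse sites -/

/-- **FINE NEIGHBOURS OVER AN INTERIOR COARSE SITE STAY IN `R′`**: if all `Ω₀`-neighbours of the coarse site `b ∈ Ω` lie in `Ω`, then every
fine neighbour inside `R′₀` of a fine point of the block of `b` lies in `R′`. [folklore] -/
theorem fine_nbr_mem (hR'L : IsBlockUnion L R') {b : Fin (d + 1) → ℤ} (hint : ∀ z ∈ nbrs b, z ∈ R'₀.image (blk L) → z ∈ R'.image (blk L))
    (hb : b ∈ R'.image (blk L)) {x y : Fin (d + 1) → ℤ} (hx : blk L x = b) (hy : y ∈ nbrs x) (hy₀ : y ∈ R'₀) : y ∈ R' := by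
  have hL : 1 ≤ L := NeZero.one_le
  refine mem_of_blk_mem hR'L ?_
  rcases blk_eq_or_mem_nbrs_of_mem_nbrs hL hy with h | h
  · rw [h, hx]; exact hb
  · rw [hx] at h
    exact hint _ h (Finset.mem_image_of_mem _ hy₀)

/-- **`H_B` ON TWO REGIONS AGREES AT AN INTERIOR ROW SITE**: `H_B^{Ω₀}(φc, φc′) = H_B^{Ω}(c, c′)` whenever all `Ω₀`-neighbours of `site c` lie
in `Ω` (the double sum over `R′₀` restricts to `R′`, where the fine operators agree entrywise). [cite: Balaban1983RegularityDecay, p.579 after (2.22) «the terms … are the same in both representations», mechanism] [folklore] -/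
theorem runB_phiL (hR'L : IsBlockUnion L R') (hR'₀L : IsBlockUnion L R'₀) (hsub : R' ⊆ R'₀) (n : ℕ) (a : ℝ) (c c' : Idx L R')
    (hc : ∀ z ∈ nbrs (site c).1, z ∈ R'₀.image (blk L) → z ∈ R'.image (blk L)) :
    runB hR'₀L n a (phiL (Finset.image_subset_image hsub) c) (phiL (Finset.image_subset_image hsub) c') = runB hR'L n a c c' := by
  rw [runB_apply, runB_apply]
  congr 1
  -- the inner sums restrict to `R′`
  have hinner : ∀ y' : ↥R'₀, ∑ x' : ↥R'₀, coordT hR'₀L x' (phiL (Finset.image_subset_image hsub) c) * fineOpR (n * L) a 0 R'₀ x' y' =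
      ∑ x'' : ↥R', coordT hR'L x'' c * fineOpR (n * L) a 0 R'₀ (incl hsub x'') y' := by
    intro y'
    have h : ∀ x' : ↥R'₀, coordT hR'₀L x' (phiL (Finset.image_subset_image hsub) c) * fineOpR (n * L) a 0 R'₀ x' y' =
        if hx : x'.1 ∈ R' then (fun x'' : ↥R' => coordT hR'L x'' c * fineOpR (n * L) a 0 R'₀ (incl hsub x'') y') ⟨x'.1, hx⟩ else 0 := by
      intro x'
      rw [coordT_phiL hR'L hR'₀L hsub]
      by_cases hx : x'.1 ∈ R'
      · rw [dif_pos hx, dif_pos hx]; rfl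
      · rw [dif_neg hx, dif_neg hx, zero_mul]
    exact (Finset.sum_congr rfl fun x' _ => h x').trans
      (sum_dite_mem hsub (fun x'' : ↥R' => coordT hR'L x'' c * fineOpR (n * L) a 0 R'₀ (incl hsub x'') y'))
  simp_rw [hinner]
  -- the outer sum restricts to `R′`
  have houter : ∀ y' : ↥R'₀, (∑ x'' : ↥R', coordT hR'L x'' c * fineOpR (n * L) a 0 R'₀ (incl hsub x'') y') *
      coordT hR'₀L y' (phiL (Finset.image_subset_image hsub) c') =
      if hy : y'.1 ∈ R' then (fun y'' : ↥R' => (∑ x'' : ↥R', coordT hR'L x'' c * fineOpR (n * L) a 0 R'₀ (incl hsub x'') (incl hsub y'')) *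
        coordT hR'L y'' c') ⟨y'.1, hy⟩ else 0 := by
    intro y'
    rw [coordT_phiL hR'L hR'₀L hsub]
    by_cases hy : y'.1 ∈ R'
    · rw [dif_pos hy, dif_pos hy]; rfl
    · rw [dif_neg hy, dif_neg hy, mul_zero]
  rw [(Finset.sum_congr rfl fun y' _ => houter y').trans (sum_dite_mem hsub (fun y'' : ↥R' =>
    (∑ x'' : ↥R', coordT hR'L x'' c * fineOpR (n * L) a 0 R'₀ (incl hsub x'') (incl hsub y'')) * coordT hR'L y'' c'))]
  -- termwise: the fine operators agree on the block of `site c`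
  refine Finset.sum_congr rfl fun y'' _ => ?_
  congr 1
  refine Finset.sum_congr rfl fun x'' _ => ?_
  by_cases hT : coordT hR'L x'' c = 0
  · rw [hT, zero_mul, zero_mul]
  · congr 1
    have hbx : blk L x''.1 = (site c).1 := blk_eq_site_of_coordT_ne_zero hR'L hT
    refine (fineOpR_apply_eq_of_interior hsub (x := incl hsub x'') (y := incl hsub y'') x''.2 y''.2 (Or.inr ?_)).symm
    intro z hz hz₀
    exact fine_nbr_mem hR'L hc (site c).2 hbx hz hz₀

/-- **`𝒫♮(s)` ON TWO REGIONS AGREES AT AN INTERIOR ROW SITE** (all four blocks). [cite: Balaban1983RegularityDecay, p.579 after (2.22), mechanism] [folklore] -/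
theorem extLine_phiL (hR'L : IsBlockUnion L R') (hR'₀L : IsBlockUnion L R'₀) (hsub : R' ⊆ R'₀) (n : ℕ) (a s : ℝ) (c c' : Idx L R')
    (hc : ∀ z ∈ nbrs (site c).1, z ∈ R'₀.image (blk L) → z ∈ R'.image (blk L)) :
    extLine hR'₀L n a s (phiL (Finset.image_subset_image hsub) c) (phiL (Finset.image_subset_image hsub) c') = extLine hR'L n a s c c' := by
  have hB := runB_phiL hR'L hR'₀L hsub n a c c' hc
  rcases c with b | p <;> rcases c' with b' | q
  · have hA : runA n L a R'₀ (incl (Finset.image_subset_image hsub) b) (incl (Finset.image_subset_image hsub) b') = runA n L a R' b b' := by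
      unfold runA
      exact (fineOpR_apply_eq_of_interior (Finset.image_subset_image hsub) (x := incl (Finset.image_subset_image hsub) b)
        (y := incl (Finset.image_subset_image hsub) b') b.2 b'.2 (Or.inr hc)).symm
    simp only [phiL] at hB ⊢
    rw [extLine_apply_inl_inl, extLine_apply_inl_inl, hA, hB]
  · simp only [phiL] at hB ⊢
    rw [extLine_apply_inl_inr, extLine_apply_inl_inr, hB]
  · simp only [phiL] at hB ⊢
    rw [extLine_apply_inr_inl, extLine_apply_inr_inl, hB]
  · simp only [phiL] at hB ⊢
    rw [extLine_apply_inr_inr, extLine_apply_inr_inr, hB]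

/-- **INTERIOR LABELS CARRY THE SAME REGION BLOCK, FOR THE LINE**: for `J ∉ bdryLab W ρ K Ω Ω₀` and two coordinate labels `x, y` whose sites
lie in the `Ω₀`-region of `J`, the padded `𝒫♮_Ω(s)` and `𝒫♮_{Ω₀}(s)` have the same entry at `(x, y)` — the agreement hypothesis of file 22
DISCHARGED for the two-cutoff line. [cite: Balaban1983RegularityDecay, p.579 after (2.22), mechanism] [folklore] -/
theorem padE_extLine_agree (hR'L : IsBlockUnion L R') (hR'₀L : IsBlockUnion L R'₀) (hsub : R' ⊆ R'₀) (n : ℕ) (a s : ℝ) {W ρ : ℕ}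
    (K : Fin (d + 1) → ℕ) {J : Lab K} (hJ : J ∉ bdryLab W ρ K (R'.image (blk L)) (R'₀.image (blk L)))
    (x : Idx L R'₀) (hx : site x ∈ region (R'₀.image (blk L)) W ρ J.1)
    (y : Idx L R'₀) (hy : site y ∈ region (R'₀.image (blk L)) W ρ J.1) :
    padE (psiL R') (extLine hR'L n a s) x y = extLine hR'₀L n a s x y := by
  classical
  simp only [bdryLab, Finset.mem_filter, Finset.mem_univ, true_and, not_not] at hJ
  have hxΩ := (hJ (site x) hx).1
  have hyΩ := (hJ (site y) hy).1
  -- `x` and `y` are image points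
  obtain ⟨c, hc⟩ : ∃ c, psiL R' x = some c := by
    cases h : psiL R' x with
    | none => exact absurd ((psiL_eq_none_iff x).1 h) (not_not.2 hxΩ)
    | some c => exact ⟨c, rfl⟩
  obtain ⟨c', hc'⟩ : ∃ c', psiL R' y = some c' := by
    cases h : psiL R' y with
    | none => exact absurd ((psiL_eq_none_iff y).1 h) (not_not.2 hyΩ)
    | some c' => exact ⟨c', rfl⟩
  have hφc : phiL (Finset.image_subset_image hsub) c = x := phiL_psiL _ x c hc
  have hφc' : phiL (Finset.image_subset_image hsub) c' = y := phiL_psiL _ y c' hc'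
  rw [padE_apply_some_some (psiL R') _ hc hc', ← hφc, ← hφc']
  refine (extLine_phiL hR'L hR'₀L hsub n a s c c' ?_).symm
  have hs : (site (phiL (Finset.image_subset_image hsub) c)).1 = (site c).1 := by rw [site_phiL]; rfl
  rw [← hs, hφc]
  exact (hJ (site x) hx).2

end Summit.QuantumFields.BalabanUV.T4Continuum.NE7K1LinWalkLinePad

end
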